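import Mathlib
import Literature.AlgebraicGeometry.Tropical.InitialIdeal
import Summits.ResolutionOfSingularities.ResolutionOfSingularities.Theorems.TropicalLinksInductiveStepExtIdealPresentation

/-!
# TropicalLinks / InductiveStep — the schön clause at the weight `w = 0`

Route `ResolutionOfSingularities/TropicalLinks`, crux `InductiveStep` (stmt-ResolutionOfSingularities-17233),
line `split`, in support of stub `stub_sncClosureSchon`.

The conclusion of `SchonAt p d` asks, for the re-embedded principal open `U[G⁻¹] ⊆ 𝔾_m^(N+m)`
(extended ideal `I' = ⟨ι(I), y_j − ι(G_j)⟩ ⊆ k[ℤ^(N+m)]`), that for EVERY integer weight `w` the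
initial degeneration `k[ℤ^(N+m)] ⧸ in_w(I')` be regular at all primes. At `w = 0` every term of every
Laurent polynomial has weight `0`, so `in_0(f) = f` and `in_0(I') = I'`; by the presentation
`tropicalLinks_extIdeal_presentation` (`k[ℤ^(N+m)] ⧸ I' ≃ₐ[k] (k[ℤ^N] ⧸ I)[(∏ G_j)⁻¹]`) the `w = 0`
clause is therefore EQUIVALENT to "the principal open `U[G⁻¹]` is regular" — the hypothesis shape
`∀ P : Ideal (Localization.Away (Ideal.Quotient.mk I g)), IsRegularLocalRing (Localization.AtPrime P)`
of the split's stubs (`m = 1`, `G = g`). This file proves that equivalence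
(`tropicalLinks_schonClause_weight_zero_iff`, route's inlined terms, the `Finsupp.filter` predicate
elaborated under `open scoped Classical` exactly as in the route file) together with two transport
lemmas (equality of ideals; ring isomorphisms, through `IsLocalization.ringEquivOfRingEquiv` on the
localizations at corresponding primes).
-/

-- single-problem summit: the doubled namespace component `ResolutionOfSingularities` is forced
set_option linter.dupNamespace false

namespace Summit.ResolutionOfSingularities.ResolutionOfSingularities.Theorems

open AddMonoidAlgebra

/-! ### The schön clause at the weight `w = 0` -/

/-- Transport of "every localization of `R ⧸ J` at a prime ideal is a regular local ring" along an
equality of ideals `J₁ = J₂`. [folklore] -/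
theorem tropicalLinks_forall_prime_regular_congr {R : Type} [CommRing R] {J₁ J₂ : Ideal R}
    (h : J₁ = J₂) :
    (∀ (P : Ideal (R ⧸ J₁)) [P.IsPrime], IsRegularLocalRing (Localization.AtPrime P)) ↔
      ∀ (P : Ideal (R ⧸ J₂)) [P.IsPrime], IsRegularLocalRing (Localization.AtPrime P) := by
  subst h
  exact Iff.rfl

/-- **Regularity at all primes is invariant under ring isomorphisms**: if every localization of `A`
at a prime is a regular local ring and `e : A ≃+* B`, the same holds for `B` (the prime `Q ⊆ B`
pulls back to `P = e⁻¹(Q)` and `e` induces `A_P ≃+* B_Q`). [folklore] -/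
theorem tropicalLinks_forall_prime_regular_of_ringEquiv {A B : Type} [CommRing A] [CommRing B]
    (e : A ≃+* B)
    (h : ∀ (P : Ideal A) [P.IsPrime], IsRegularLocalRing (Localization.AtPrime P)) :
    ∀ (Q : Ideal B) [Q.IsPrime], IsRegularLocalRing (Localization.AtPrime Q) := by
  intro Q hQ
  haveI : (Q.comap e.toRingHom).IsPrime := Ideal.comap_isPrime _ _
  haveI := h (Q.comap e.toRingHom)
  have H : (Q.comap e.toRingHom).primeCompl.map e.toMonoidHom = Q.primeCompl := by
    ext b
    simp only [Submonoid.mem_map, Ideal.mem_primeCompl_iff, Ideal.mem_comap]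
    constructor
    · rintro ⟨a, ha, rfl⟩
      exact ha
    · intro hb
      exact ⟨e.symm b, by simpa using hb, e.apply_symm_apply b⟩
  exact IsRegularLocalRing.of_ringEquiv
    (IsLocalization.ringEquivOfRingEquiv (M := (Q.comap e.toRingHom).primeCompl) (T := Q.primeCompl)
      (Localization.AtPrime (Q.comap e.toRingHom)) (Localization.AtPrime Q) e H)

open scoped Classical in
/-- **The schön clause of `SchonAt` at the weight `w = 0` is regularity of the principal open.** For
`x = ∏ mk(G_j)`: every localization at a prime of the degeneration `k[ℤ^(N+m)] ⧸ in_0(I')` (the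
route's inlined initial ideal at the zero weight, which is `I'` itself) is regular iff every
localization at a prime of `(k[ℤ^N] ⧸ I)[x⁻¹]` is — via `in_0(I') = I'` and the presentation
`tropicalLinks_extIdeal_presentation`. [folklore] -/
theorem tropicalLinks_schonClause_weight_zero_iff :
    ∀ (k : Type) [Field k] (N m : ℕ) (I : Ideal (AddMonoidAlgebra k (Fin N → ℤ))) (G : Fin m → AddMonoidAlgebra k (Fin N → ℤ)) (x : AddMonoidAlgebra k (Fin N → ℤ) ⧸ I), x = Ideal.Quotient.mk I (∏ j, G j) → ∀ w : Fin (N + m) → ℤ, w = 0 → ((∀ (P : Ideal (Localization.Away x)) [P.IsPrime], IsRegularLocalRing (Localization.AtPrime P)) ↔ ∀ (P : Ideal (AddMonoidAlgebra k (Fin (N + m) → ℤ) ⧸ Ideal.span ((fun f : AddMonoidAlgebra k (Fin (N + m) → ℤ) => AddMonoidAlgebra.ofCoeff (f.coeff.filter fun v => ∀ u ∈ f.coeff.support, ∑ i, w i * v i ≤ ∑ i, w i * u i)) '' (↑(Ideal.span ((fun f : AddMonoidAlgebra k (Fin N → ℤ) => (AddMonoidAlgebra.ofCoeff (f.coeff.mapDomain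 fun v => Fin.append v (0 : Fin m → ℤ)) : AddMonoidAlgebra k (Fin (N + m) → ℤ))) '' (↑I : Set (AddMonoidAlgebra k (Fin N → ℤ))) ∪ Set.range (fun j : Fin m => AddMonoidAlgebra.single (Fin.append (0 : Fin N → ℤ) (Pi.single j (1 : ℤ))) (1 : k) - AddMonoidAlgebra.ofCoeff ((G j).coeff.mapDomain fun v => Fin.append v (0 : Fin m → ℤ))))) : Set (AddMonoidAlgebra k (Fin (N + m) → ℤ)))))) [P.IsPrime], IsRegularLocalRing (Localization.AtPrime P)) := by
  intro k _ N m I G x hx w hw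
  subst hw
  obtain ⟨e, -, -⟩ := tropicalLinks_extIdeal_presentation k N m I G x hx
  generalize hT : ((fun f : AddMonoidAlgebra k (Fin N → ℤ) => (AddMonoidAlgebra.ofCoeff (f.coeff.mapDomain fun v => Fin.append v (0 : Fin m → ℤ)) : AddMonoidAlgebra k (Fin (N + m) → ℤ))) '' (↑I : Set (AddMonoidAlgebra k (Fin N → ℤ))) ∪ Set.range (fun j : Fin m => AddMonoidAlgebra.single (Fin.append (0 : Fin N → ℤ) (Pi.single j (1 : ℤ))) (1 : k) - AddMonoidAlgebra.ofCoeff ((G j).coeff.mapDomain fun v => Fin.append v (0 : Fin m → ℤ)))) = T at e ⊢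
  -- `in_0` is the identity on elements, so `in_0(I') = I'`
  have hin0 : ∀ f : AddMonoidAlgebra k (Fin (N + m) → ℤ),
      AddMonoidAlgebra.ofCoeff (f.coeff.filter fun v => ∀ u ∈ f.coeff.support,
        ∑ i, (0 : Fin (N + m) → ℤ) i * v i ≤ ∑ i, (0 : Fin (N + m) → ℤ) i * u i) = f := by
    intro f
    conv_rhs => rw [← AddMonoidAlgebra.ofCoeff_coeff f]
    congr 1
    rw [Finsupp.filter_eq_self_iff]
    intro v _ u _
    simp
  have hJ : Ideal.span ((fun f : AddMonoidAlgebra k (Fin (N + m) → ℤ) => AddMonoidAlgebra.ofCoeff (f.coeff.filter fun v => ∀ u ∈ f.coeff.support, ∑ i, (0 : Fin (N + m) → ℤ) i * v i ≤ ∑ i, (0 : Fin (N + m) → ℤ) i * u i)) '' (↑(Ideal.span T) : Set (AddMonoidAlgebra k (Fin (N + m) → ℤ)))) = Ideal.span T := by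
    have hid : (fun f : AddMonoidAlgebra k (Fin (N + m) → ℤ) => AddMonoidAlgebra.ofCoeff (f.coeff.filter fun v => ∀ u ∈ f.coeff.support, ∑ i, (0 : Fin (N + m) → ℤ) i * v i ≤ ∑ i, (0 : Fin (N + m) → ℤ) i * u i)) = id :=
      funext hin0
    rw [hid, Set.image_id, Ideal.span_eq]
  rw [tropicalLinks_forall_prime_regular_congr hJ]
  constructor
  · intro h
    exact tropicalLinks_forall_prime_regular_of_ringEquiv e.symm.toRingEquiv h
  · intro h
    exact tropicalLinks_forall_prime_regular_of_ringEquiv e.toRingEquiv h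

end Summit.ResolutionOfSingularities.ResolutionOfSingularities.Theorems
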